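import Literature.Analysis.Complex.RiemannExtension
import Mathlib.Analysis.Complex.AbsMax
import Mathlib.Analysis.Calculus.DSlope
import Mathlib.Analysis.Calculus.MeanValue
import Mathlib.Topology.MetricSpace.Contracting
import HarnessLib

/-!
# Division by the equation of a smooth hypersurface

Local complex analysis in several variables (E. M. Chirka, *Complex Analytic Sets* (1989), §2.8
and A1.4; R. C. Gunning, H. Rossi, *Analytic Functions of Several Complex Variables* (1965),
Ch. I §B): if `t` is holomorphic on an open set `U` of a complex normed space and `dt(x) ≠ 0` at
every zero `x` of `t` in `U` (so `Y = {t = 0} ∩ U` is a smooth complex hypersurface and `t` is a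
REDUCED equation of it), then every holomorphic `f` on `U` vanishing on `Y` is divisible by `t`:
`f = t • g` with `g` holomorphic on `U` (`exists_eq_smul_of_eqOn_zero`), and the quotient is unique
(`eqOn_of_smul_eq_smul`). This is the statement "`t` generates the ideal of `Y` at each of its
points" in the global form consumed by Čech computations with the sheaf sequence
`0 → 𝒪(L ⊗ 𝓗⁻¹) →ᵗ 𝒪(L) → 𝒪_Y(L) → 0` of a hyperplane section.

The proof is one-variable along a direction `v` with `dt(a) v = 1`: on the complex lines
`s ↦ x + s v`, `x` near a zero `a`, the slice `Φ_x(s) = t(x + s v)` satisfies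
`‖Φ_x(s) - Φ_x(s') - (s - s')‖ ≤ ‖s - s'‖/2` (mean value inequality, `dt ≈ dt(a)` nearby), hence has
at most one zero `s₀` in a small disc, a simple one, off which it is bounded below on the boundary
circle; dividing `f(x + s v)` and `Φ_x(s)` by `s - s₀` (`dslope`) the quotient `f/t` restricted to
the line is holomorphic on the disc, and the maximum modulus principle bounds `‖f x / t x‖`
uniformly. So `f/t` is locally bounded near `Y`, and the Riemann extension theorem of the tree
(`SCV.exists_differentiableOn_eqOn_of_thin`) extends it across the thin set `Y`.

The companion file `TransversalHypersurfaces.lean` records that the hypersurface passes near every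
nearby point (a zero of the slice exists, by contraction) and the corollary that `(t₁, t₂)` is a
regular pair on sections when two such hypersurfaces meet transversally.

Everything is proved; theorems only.

## References

* E. M. Chirka, *Complex Analytic Sets*, Kluwer (1989), §2.8 (smooth points, minimal defining
  functions) and A1.4. [Chirka1989]
* R. C. Gunning, H. Rossi, *Analytic Functions of Several Complex Variables* (1965), Ch. I §B,
  Ch. II §E (local parametrization at regular points). [folklore]
-/

noncomputable section

open Metric Set Filter
open scoped Topology

namespace Literature.Analysis.Complex
namespace SCV

variable {E : Type*} [NormedAddCommGroup E] [NormedSpace ℂ E]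
  {F : Type*} [NormedAddCommGroup F] [NormedSpace ℂ F]

/-! ### One complex variable: maps with derivative close to `1` -/

/-- **A holomorphic map of one variable with `‖Φ' - 1‖ ≤ 1/2` on a convex set moves differences by
at most half**: `‖Φ s - Φ s' - (s - s')‖ ≤ ‖s - s'‖ / 2` (mean value inequality for `Φ - id`).
[folklore] -/
theorem norm_sub_sub_sub_le_of_norm_deriv_sub_one_le {Φ : ℂ → ℂ} {D : Set ℂ} (hD : Convex ℝ D)
    (hΦ : ∀ s ∈ D, DifferentiableAt ℂ Φ s) (hΦ' : ∀ s ∈ D, ‖deriv Φ s - 1‖ ≤ 1 / 2)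
    {s s' : ℂ} (hs : s ∈ D) (hs' : s' ∈ D) :
    ‖Φ s - Φ s' - (s - s')‖ ≤ ‖s - s'‖ / 2 := by
  have key := hD.norm_image_sub_le_of_norm_hasDerivWithin_le (f := fun u ↦ Φ u - u)
    (f' := fun u ↦ deriv Φ u - 1) (fun u hu ↦ ((hΦ u hu).hasDerivAt.sub (hasDerivAt_id u)).hasDerivWithinAt)
    hΦ' hs' hs
  calc ‖Φ s - Φ s' - (s - s')‖ = ‖(Φ s - s) - (Φ s' - s')‖ := by ring_nf
    _ ≤ 1 / 2 * ‖s - s'‖ := key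
    _ = ‖s - s'‖ / 2 := by ring

/-- Such a map is injective on `D`: two zeros coincide. [folklore] -/
theorem eq_of_eq_of_norm_deriv_sub_one_le {Φ : ℂ → ℂ} {D : Set ℂ} (hD : Convex ℝ D)
    (hΦ : ∀ s ∈ D, DifferentiableAt ℂ Φ s) (hΦ' : ∀ s ∈ D, ‖deriv Φ s - 1‖ ≤ 1 / 2)
    {s s' : ℂ} (hs : s ∈ D) (hs' : s' ∈ D) (h : Φ s = Φ s') : s = s' := by
  have key := norm_sub_sub_sub_le_of_norm_deriv_sub_one_le hD hΦ hΦ' hs hs'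
  rw [h, sub_self, zero_sub, norm_neg] at key
  have : ‖s - s'‖ = 0 := by linarith [norm_nonneg (s - s')]
  exact sub_eq_zero.1 (norm_eq_zero.1 this)

/-- **Lower bound on a circle**: if moreover `‖Φ 0‖ ≤ r / 8` then `‖Φ s‖ ≥ 3r/8` for `‖s‖ = r`
(`D ∋ 0` containing the circle). [folklore] -/
theorem norm_le_norm_apply_of_norm_deriv_sub_one_le {Φ : ℂ → ℂ} {D : Set ℂ} (hD : Convex ℝ D)
    (hΦ : ∀ s ∈ D, DifferentiableAt ℂ Φ s) (hΦ' : ∀ s ∈ D, ‖deriv Φ s - 1‖ ≤ 1 / 2)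
    (h0 : (0 : ℂ) ∈ D) {r : ℝ} (hΦ0 : ‖Φ 0‖ ≤ r / 8) {s : ℂ} (hs : s ∈ D) (hsr : ‖s‖ = r) :
    3 * r / 8 ≤ ‖Φ s‖ := by
  have key := norm_sub_sub_sub_le_of_norm_deriv_sub_one_le hD hΦ hΦ' hs h0
  rw [sub_zero] at key
  have h1 : ‖s‖ - ‖Φ s - Φ 0‖ ≤ ‖Φ s - Φ 0 - s‖ := by
    have := norm_sub_norm_le s (Φ s - Φ 0)
    rw [← norm_neg (s - (Φ s - Φ 0)), neg_sub] at this
    linarith [abs_le.1 (abs_norm_sub_norm_le s (Φ s - Φ 0))]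
  have h2 : ‖Φ s - Φ 0‖ ≤ ‖Φ s‖ + ‖Φ 0‖ := norm_sub_le _ _
  linarith

/-- **A zero, if any, is close to the centre**: if `Φ s₀ = 0` with `s₀ ∈ D ∋ 0` then
`‖s₀‖ ≤ 2 ‖Φ 0‖`. [folklore] -/
theorem norm_le_two_mul_norm_apply_zero_of_eq_zero {Φ : ℂ → ℂ} {D : Set ℂ} (hD : Convex ℝ D)
    (hΦ : ∀ s ∈ D, DifferentiableAt ℂ Φ s) (hΦ' : ∀ s ∈ D, ‖deriv Φ s - 1‖ ≤ 1 / 2)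
    (h0 : (0 : ℂ) ∈ D) {s₀ : ℂ} (hs₀ : s₀ ∈ D) (hΦs₀ : Φ s₀ = 0) : ‖s₀‖ ≤ 2 * ‖Φ 0‖ := by
  have key := norm_sub_sub_sub_le_of_norm_deriv_sub_one_le hD hΦ hΦ' hs₀ h0
  rw [hΦs₀, zero_sub, sub_zero] at key
  have h1 : ‖s₀‖ - ‖Φ 0‖ ≤ ‖-Φ 0 - s₀‖ := by
    have := norm_sub_norm_le s₀ (-Φ 0)
    rw [norm_neg, ← norm_neg (s₀ - -Φ 0), neg_sub] at this
    exact this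
  linarith

/-- **Existence of a zero by contraction**: if `‖Φ' - 1‖ ≤ 1/2` on the closed disc
`closedBall 0 r` and `‖Φ 0‖ ≤ r / 2`, then `Φ` has a zero in the disc (`s ↦ s - Φ s` is a
`1/2`-contraction of the complete disc into itself; Banach's fixed point theorem). [folklore] -/
theorem exists_eq_zero_of_norm_deriv_sub_one_le {Φ : ℂ → ℂ} {r : ℝ} (hr : 0 ≤ r)
    (hΦ : ∀ s ∈ closedBall (0 : ℂ) r, DifferentiableAt ℂ Φ s)
    (hΦ' : ∀ s ∈ closedBall (0 : ℂ) r, ‖deriv Φ s - 1‖ ≤ 1 / 2) (hΦ0 : ‖Φ 0‖ ≤ r / 2) :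
    ∃ s₀ ∈ closedBall (0 : ℂ) r, Φ s₀ = 0 := by
  set T : ℂ → ℂ := fun s ↦ s - Φ s with hT
  have hD : Convex ℝ (closedBall (0 : ℂ) r) := convex_closedBall _ _
  have hlip : ∀ s ∈ closedBall (0 : ℂ) r, ∀ s' ∈ closedBall (0 : ℂ) r,
      ‖T s - T s'‖ ≤ ‖s - s'‖ / 2 := fun s hs s' hs' ↦ by
    have := norm_sub_sub_sub_le_of_norm_deriv_sub_one_le hD hΦ hΦ' hs hs'
    rw [hT]
    calc ‖s - Φ s - (s' - Φ s')‖ = ‖Φ s - Φ s' - (s - s')‖ := by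
          rw [← norm_neg]; ring_nf
      _ ≤ ‖s - s'‖ / 2 := this
  have hmaps : MapsTo T (closedBall (0 : ℂ) r) (closedBall (0 : ℂ) r) := fun s hs ↦ by
    have h1 := hlip s hs 0 (mem_closedBall_self hr)
    rw [mem_closedBall, dist_zero_right] at hs ⊢
    have h2 : ‖T 0‖ = ‖Φ 0‖ := by rw [hT]; simp
    have h3 : ‖T s‖ ≤ ‖T s - T 0‖ + ‖T 0‖ := norm_le_norm_sub_add _ _
    rw [sub_zero] at h1
    linarith
  have hK : ContractingWith (1 / 2 : NNReal) (hmaps.restrict T _ _) := by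
    refine ⟨by norm_num, LipschitzWith.of_dist_le_mul fun s s' ↦ ?_⟩
    change dist (T s) (T s') ≤ _
    rw [dist_eq_norm, Subtype.dist_eq, dist_eq_norm]
    have := hlip s s.2 s' s'.2
    push_cast
    linarith
  obtain ⟨s₀, hs₀, hfix, -⟩ := hK.exists_fixedPoint' (isClosed_closedBall.isComplete) hmaps
    (mem_closedBall_self hr) (edist_ne_top _ _)
  refine ⟨s₀, hs₀, ?_⟩
  have h := hfix.eq
  rw [hT] at h
  -- `s₀ - Φ s₀ = s₀`
  linear_combination -h

/-! ### Slices of a holomorphic function near a simple zero of `t` -/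

section Slice

variable [CompleteSpace F]

omit [CompleteSpace F] in
/-- **Uniform slice data at a reduced zero.** Let `t` be holomorphic on an open `U`, `a ∈ U`,
`t a = 0`, `dt(a) ≠ 0`, and let `f` be holomorphic on `U` with `f = 0` on `{t = 0} ∩ U`. Then
there are a direction `v`, radii `δ, r > 0` and a neighbourhood `W` of `a` such that for every
`x ∈ W`: the points `x + s v`, `‖s‖ < 2r`, lie in `U`, `‖f‖ ≤ 1` there, the slice
`Φ_x(s) = t (x + s v)` has `‖Φ_x' - 1‖ ≤ 1/2` on `‖s‖ < 2r`, and `‖t x‖ ≤ r / 8`. [folklore] -/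
theorem exists_slice_data {t : E → ℂ} {f : E → F} {U : Set E} (hU : IsOpen U)
    (ht : DifferentiableOn ℂ t U) (hf : DifferentiableOn ℂ f U) {a : E} (ha : a ∈ U) (hta : t a = 0)
    (hda : fderiv ℂ t a ≠ 0) (hfa : f a = 0) :
    ∃ (v : E) (r : ℝ), 0 < r ∧ ∃ W ∈ 𝓝 a, ∀ x ∈ W,
      (∀ s ∈ ball (0 : ℂ) (2 * r), x + s • v ∈ U ∧ ‖f (x + s • v)‖ ≤ 1 ∧
        ‖deriv (fun u : ℂ ↦ t (x + u • v)) s - 1‖ ≤ 1 / 2) ∧ ‖t x‖ ≤ r / 8 := by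
  -- a direction with `dt(a) v = 1`
  obtain ⟨w, hw⟩ : ∃ w, fderiv ℂ t a w ≠ 0 := by
    by_contra h
    push Not at h
    exact hda (ContinuousLinearMap.ext h)
  set v : E := (fderiv ℂ t a w)⁻¹ • w with hv
  have hv1 : fderiv ℂ t a v = 1 := by
    rw [hv, map_smul, smul_eq_mul, inv_mul_cancel₀ hw]
  -- continuity of `dt`, of `f` and of `t` at `a`
  have hcont : ContinuousOn (fderiv ℂ t) U := continuousOn_fderiv ht hU
  have hε : (0 : ℝ) < 1 / (2 * (‖v‖ + 1)) := by positivity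
  obtain ⟨δ₁, hδ₁, hδ₁U, hder⟩ : ∃ δ₁ > 0, ball a δ₁ ⊆ U ∧
      ∀ y ∈ ball a δ₁, ‖fderiv ℂ t y - fderiv ℂ t a‖ ≤ 1 / (2 * (‖v‖ + 1)) := by
    have h1 := (hcont.continuousWithinAt ha).continuousAt (hU.mem_nhds ha) |>.eventually
      (Metric.closedBall_mem_nhds (fderiv ℂ t a) hε)
    obtain ⟨δ₁, hδ₁, h⟩ := Metric.eventually_nhds_iff_ball.1 (h1.and (eventually_mem_set.2 (hU.mem_nhds ha)))
    exact ⟨δ₁, hδ₁, fun y hy ↦ (h y hy).2, fun y hy ↦ by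
      have := (h y hy).1; rwa [dist_eq_norm] at this⟩
  obtain ⟨δ₂, hδ₂, hf1⟩ : ∃ δ₂ > 0, ∀ y ∈ ball a δ₂, ‖f y‖ ≤ 1 := by
    have h1 := ((hf.continuousOn.continuousWithinAt ha).continuousAt (hU.mem_nhds ha)).eventually
      (Metric.closedBall_mem_nhds (f a) one_pos)
    obtain ⟨δ₂, hδ₂, h⟩ := Metric.eventually_nhds_iff_ball.1 h1
    exact ⟨δ₂, hδ₂, fun y hy ↦ by have := h y hy; rwa [hfa, dist_zero_right] at this⟩
  set δ : ℝ := min δ₁ δ₂ with hδ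
  have hδpos : 0 < δ := lt_min hδ₁ hδ₂
  set r : ℝ := δ / (3 * (‖v‖ + 1)) with hr
  have hrpos : 0 < r := by positivity
  obtain ⟨δ₃, hδ₃, ht8⟩ : ∃ δ₃ > 0, ∀ y ∈ ball a δ₃, ‖t y‖ ≤ r / 8 := by
    have h1 := ((ht.continuousOn.continuousWithinAt ha).continuousAt (hU.mem_nhds ha)).eventually
      (Metric.closedBall_mem_nhds (t a) (by positivity : (0 : ℝ) < r / 8))
    obtain ⟨δ₃, hδ₃, h⟩ := Metric.eventually_nhds_iff_ball.1 h1
    exact ⟨δ₃, hδ₃, fun y hy ↦ by have := h y hy; rwa [hta, dist_zero_right] at this⟩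
  -- the neighbourhood `W = ball a (min (δ/3) δ₃)`
  refine ⟨v, r, hrpos, ball a (min (δ / 3) δ₃), ball_mem_nhds a (lt_min (by positivity) hδ₃),
    fun x hx ↦ ⟨fun s hs ↦ ?_, ht8 x (ball_subset_ball (min_le_right _ _) hx)⟩⟩
  have hxδ : dist x a < δ / 3 := lt_of_lt_of_le (mem_ball.1 hx) (min_le_left _ _)
  -- `x + s • v ∈ ball a δ`
  have hmem : x + s • v ∈ ball a δ := by
    rw [dist_eq_norm] at hxδ
    rw [mem_ball, dist_eq_norm]
    rw [mem_ball, dist_zero_right] at hs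
    have h1 : ‖s • v‖ ≤ 2 * r * ‖v‖ := by
      rw [norm_smul]; exact mul_le_mul_of_nonneg_right hs.le (norm_nonneg v)
    have h2 : 2 * r * ‖v‖ ≤ 2 * δ / 3 := by
      have key : r * ‖v‖ ≤ δ / 3 := by
        rw [hr, div_mul_eq_mul_div, div_le_div_iff₀ (by positivity) (by positivity)]
        nlinarith [norm_nonneg v, hδpos.le]
      linarith
    calc ‖x + s • v - a‖ = ‖(x - a) + s • v‖ := by abel_nf
      _ ≤ ‖x - a‖ + ‖s • v‖ := norm_add_le _ _
      _ < δ / 3 + 2 * δ / 3 := by linarith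
      _ = δ := by ring
  have hmemU : x + s • v ∈ U := hδ₁U (ball_subset_ball (min_le_left _ _) hmem)
  refine ⟨hmemU, hf1 _ (ball_subset_ball (min_le_right _ _) hmem), ?_⟩
  -- the derivative of the slice
  have hd : HasDerivAt (fun u : ℂ ↦ t (x + u • v)) (fderiv ℂ t (x + s • v) v) s :=
    hasDerivAt_slice (ht.differentiableAt (hU.mem_nhds hmemU))
  rw [hd.deriv]
  calc ‖fderiv ℂ t (x + s • v) v - 1‖
      = ‖(fderiv ℂ t (x + s • v) - fderiv ℂ t a) v‖ := by
        rw [show (fderiv ℂ t (x + s • v) - fderiv ℂ t a) v =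
          fderiv ℂ t (x + s • v) v - fderiv ℂ t a v from rfl, hv1]
    _ ≤ ‖fderiv ℂ t (x + s • v) - fderiv ℂ t a‖ * ‖v‖ := ContinuousLinearMap.le_opNorm _ _
    _ ≤ 1 / (2 * (‖v‖ + 1)) * ‖v‖ :=
        mul_le_mul_of_nonneg_right (hder _ (ball_subset_ball (min_le_left _ _) hmem)) (norm_nonneg v)
    _ ≤ 1 / 2 := by
        rw [div_mul_eq_mul_div, one_mul, div_le_div_iff₀ (by positivity) (by positivity)]
        nlinarith [norm_nonneg v]

/-- **The quotient `f/t` is bounded near a reduced zero of `t`** (the heart of the division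
theorem): with `t, f` as in `exists_slice_data` (in particular `f = 0` on `{t = 0} ∩ U`), there
are a neighbourhood `W` of `a` and `C` with `‖(t y)⁻¹ • f y‖ ≤ C` for all `y ∈ W` with `t y ≠ 0`.
One-variable argument on the slices `s ↦ y + s v`: the slice of `t` has at most one zero `s₀` in
the disc `‖s‖ ≤ r`, with `‖s₀‖ ≤ r/4`, a simple one at which the slice of `f` vanishes too; after
dividing both by `s - s₀` (`dslope`) the quotient is holomorphic on the disc, equal to `f/t` on the
boundary circle where `‖t‖ ≥ 3r/8` and `‖f‖ ≤ 1`, and the maximum modulus principle gives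
`‖f y / t y‖ ≤ 8/(3r)`. [cite: Chirka1989, §2.8 and A1.4] -/
theorem exists_bound_smul_inv_near_zero {t : E → ℂ} {f : E → F} {U : Set E} (hU : IsOpen U)
    (ht : DifferentiableOn ℂ t U) (hf : DifferentiableOn ℂ f U) {a : E} (ha : a ∈ U) (hta : t a = 0)
    (hda : fderiv ℂ t a ≠ 0) (hft : ∀ x ∈ U, t x = 0 → f x = 0) :
    ∃ W ∈ 𝓝 a, ∃ C : ℝ, ∀ y ∈ W, t y ≠ 0 → ‖(t y)⁻¹ • f y‖ ≤ C := by
  obtain ⟨v, r, hr, W, hW, hWx⟩ := exists_slice_data hU ht hf ha hta hda (hft a ha hta)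
  refine ⟨W, hW, 8 / (3 * r), fun y hy hty ↦ ?_⟩
  obtain ⟨hsl, hty8⟩ := hWx y hy
  -- the two slices
  set Φ : ℂ → ℂ := fun u ↦ t (y + u • v) with hΦ
  set Fy : ℂ → F := fun u ↦ f (y + u • v) with hFy
  have hD : Convex ℝ (ball (0 : ℂ) (2 * r)) := convex_ball _ _
  have h0D : (0 : ℂ) ∈ ball (0 : ℂ) (2 * r) := mem_ball_self (by positivity)
  have hΦd : ∀ s ∈ ball (0 : ℂ) (2 * r), DifferentiableAt ℂ Φ s := fun s hs ↦
    (hasDerivAt_slice (ht.differentiableAt (hU.mem_nhds (hsl s hs).1))).differentiableAt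
  have hFd : ∀ s ∈ ball (0 : ℂ) (2 * r), DifferentiableAt ℂ Fy s := fun s hs ↦
    (hasDerivAt_slice (hf.differentiableAt (hU.mem_nhds (hsl s hs).1))).differentiableAt
  have hΦ' : ∀ s ∈ ball (0 : ℂ) (2 * r), ‖deriv Φ s - 1‖ ≤ 1 / 2 := fun s hs ↦ (hsl s hs).2.2
  have hΦ0 : Φ 0 = t y := by simp [hΦ]
  have hF0 : Fy 0 = f y := by simp [hFy]
  have hsub : closedBall (0 : ℂ) r ⊆ ball (0 : ℂ) (2 * r) := closedBall_subset_ball (by linarith)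
  -- lower bound for `Φ` on the circle `‖s‖ = r`
  have hcirc : ∀ s ∈ sphere (0 : ℂ) r, 3 * r / 8 ≤ ‖Φ s‖ := fun s hs ↦ by
    have hs' : ‖s‖ = r := by simpa using hs
    exact norm_le_norm_apply_of_norm_deriv_sub_one_le hD hΦd hΦ' h0D (by rwa [hΦ0])
      (hsub (sphere_subset_closedBall hs)) hs'
  have hcirc0 : ∀ s ∈ sphere (0 : ℂ) r, Φ s ≠ 0 := fun s hs h ↦ by
    have := hcirc s hs; rw [h, norm_zero] at this; linarith
  -- a holomorphic function on the closed disc which is `f/t` on the circle and at `0`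
  obtain ⟨h, hhd, hh0, hhc⟩ : ∃ h : ℂ → F, DiffContOnCl ℂ h (ball (0 : ℂ) r) ∧
      h 0 = (t y)⁻¹ • f y ∧ ∀ s ∈ sphere (0 : ℂ) r, h s = (Φ s)⁻¹ • Fy s := by
    by_cases hz : ∃ s₀ ∈ closedBall (0 : ℂ) r, Φ s₀ = 0
    · -- Case: a (unique, simple) zero `s₀` in the disc
      obtain ⟨s₀, hs₀, hΦs₀⟩ := hz
      have hs₀D : s₀ ∈ ball (0 : ℂ) (2 * r) := hsub hs₀
      have hs₀r : ‖s₀‖ < r := by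
        have h1 := norm_le_two_mul_norm_apply_zero_of_eq_zero hD hΦd hΦ' h0D hs₀D hΦs₀
        rw [hΦ0] at h1
        linarith
      have hFs₀ : Fy s₀ = 0 := hft _ (hsl s₀ hs₀D).1 hΦs₀
      -- the divided slices
      set Φ₁ : ℂ → ℂ := dslope Φ s₀ with hΦ₁
      set F₁ : ℂ → F := dslope Fy s₀ with hF₁
      have hball : ball (0 : ℂ) (2 * r) ∈ 𝓝 s₀ := isOpen_ball.mem_nhds hs₀D
      have hΦ₁d : DifferentiableOn ℂ Φ₁ (ball (0 : ℂ) (2 * r)) :=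
        (Complex.differentiableOn_dslope hball).2 fun s hs ↦ (hΦd s hs).differentiableWithinAt
      have hF₁d : DifferentiableOn ℂ F₁ (ball (0 : ℂ) (2 * r)) :=
        (Complex.differentiableOn_dslope hball).2 fun s hs ↦ (hFd s hs).differentiableWithinAt
      have hΦfac : ∀ s, Φ s = (s - s₀) * Φ₁ s := fun s ↦ by
        have := sub_smul_dslope Φ s₀ s
        rw [smul_eq_mul, hΦs₀, sub_zero] at this
        exact this.symm
      have hFfac : ∀ s, Fy s = (s - s₀) • F₁ s := fun s ↦ by
        have := sub_smul_dslope Fy s₀ s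
        rw [hFs₀, sub_zero] at this
        exact this.symm
      -- `Φ₁` does not vanish on the closed disc
      have hΦ₁ne : ∀ s ∈ closedBall (0 : ℂ) r, Φ₁ s ≠ 0 := fun s hs ↦ by
        by_cases hss₀ : s = s₀
        · subst hss₀
          rw [hΦ₁, dslope_same]
          intro h0
          have := hΦ' s (hsub hs)
          rw [h0, zero_sub, norm_neg, norm_one] at this
          linarith
        · intro h0
          have h1 : Φ s = 0 := by rw [hΦfac s, h0, mul_zero]
          exact hss₀ (eq_of_eq_of_norm_deriv_sub_one_le hD hΦd hΦ' (hsub hs) hs₀D (h1.trans hΦs₀.symm))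
      refine ⟨fun s ↦ (Φ₁ s)⁻¹ • F₁ s, ?_, ?_, fun s hs ↦ ?_⟩
      · -- holomorphic on a neighbourhood of the closed disc
        apply DifferentiableOn.diffContOnCl
        rw [closure_ball (0 : ℂ) hr.ne']
        intro s hs
        have hsD := hsub hs
        exact (((hΦ₁d s hsD).differentiableAt (isOpen_ball.mem_nhds hsD)).inv (hΦ₁ne s hs)).smul
          ((hF₁d s hsD).differentiableAt (isOpen_ball.mem_nhds hsD)) |>.differentiableWithinAt
      · -- value at `0`
        have h00 : (0 : ℂ) ≠ s₀ := by
          rintro rfl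
          exact hty (by rw [← hΦ0]; exact hΦs₀)
        change (Φ₁ 0)⁻¹ • F₁ 0 = _
        rw [hΦ₁, hF₁, dslope_of_ne _ h00, dslope_of_ne _ h00, slope_def_module, slope_def_module,
          hΦs₀, hFs₀, sub_zero, sub_zero, hΦ0, hF0, smul_eq_mul, smul_smul]
        congr 1
        have h0s : (0 : ℂ) - s₀ ≠ 0 := sub_ne_zero.2 h00
        rw [mul_inv, inv_inv, mul_comm (0 - s₀) _, mul_assoc, mul_inv_cancel₀ h0s, mul_one]
      · -- value on the circle
        have hss₀ : s ≠ s₀ := fun h ↦ by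
          rw [h] at hs; have : ‖s₀‖ = r := by simpa using hs
          linarith
        change (Φ₁ s)⁻¹ • F₁ s = _
        have hne : s - s₀ ≠ 0 := sub_ne_zero.2 hss₀
        rw [hΦfac s, hFfac s, smul_smul]
        congr 1
        rw [mul_inv, mul_comm (s - s₀)⁻¹ (Φ₁ s)⁻¹, mul_assoc, inv_mul_cancel₀ hne, mul_one]
    · -- Case: no zero in the disc
      push Not at hz
      refine ⟨fun s ↦ (Φ s)⁻¹ • Fy s, ?_, by simp [hΦ0, hF0], fun s _ ↦ rfl⟩
      apply DifferentiableOn.diffContOnCl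
      rw [closure_ball (0 : ℂ) hr.ne']
      intro s hs
      exact (((hΦd s (hsub hs)).inv (hz s hs)).smul (hFd s (hsub hs))).differentiableWithinAt
  -- maximum modulus principle on the disc
  rw [← hh0]
  refine Complex.norm_le_of_forall_mem_frontier_norm_le isBounded_ball hhd (fun s hs ↦ ?_)
    (subset_closure (mem_ball_self hr))
  rw [frontier_ball (0 : ℂ) hr.ne'] at hs
  rw [hhc s hs, norm_smul, norm_inv]
  have h1 := hcirc s hs
  have h2 : ‖Fy s‖ ≤ 1 := (hsl s (hsub (sphere_subset_closedBall hs))).2.1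
  have h3 : 0 < ‖Φ s‖ := by linarith
  calc ‖Φ s‖⁻¹ * ‖Fy s‖ ≤ (3 * r / 8)⁻¹ * 1 := by
        gcongr
    _ = 8 / (3 * r) := by field_simp

end Slice

/-! ### The division theorem -/

section Division

variable [CompleteSpace F]

/-- **Reduced equations are not locally zero**: if `t a = 0` and `dt(a) ≠ 0` then `t` does not
vanish identically near `a`. [folklore] -/
theorem not_eventuallyEq_zero_of_fderiv_ne_zero {t : E → ℂ} {a : E} (hda : fderiv ℂ t a ≠ 0) :
    ¬ t =ᶠ[𝓝 a] 0 := fun h ↦ hda (by rw [h.fderiv_eq]; exact fderiv_const_apply 0)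

/-- **Division by the equation of a smooth hypersurface.** Let `t` be holomorphic on an open set
`U` of a complex normed space with `dt(x) ≠ 0` at every zero `x ∈ U` of `t`, and let `f`
(holomorphic on `U`, values in a complete space) vanish on `{t = 0} ∩ U`. Then `f = t • g` on `U`
for some `g` holomorphic on `U`. (Riemann extension of `f/t` across the thin set `{t = 0}`, which is
locally bounded by `exists_bound_smul_inv_near_zero`.) [cite: Chirka1989, §2.8 and A1.4] -/
theorem exists_eq_smul_of_eqOn_zero {t : E → ℂ} {f : E → F} {U : Set E} (hU : IsOpen U)
    (ht : DifferentiableOn ℂ t U) (hf : DifferentiableOn ℂ f U)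
    (hdt : ∀ x ∈ U, t x = 0 → fderiv ℂ t x ≠ 0) (hft : ∀ x ∈ U, t x = 0 → f x = 0) :
    ∃ g : E → F, DifferentiableOn ℂ g U ∧ ∀ x ∈ U, f x = t x • g x := by
  set A : Set E := t ⁻¹' {0} with hA
  have hUA : IsOpen (U \ A) := by
    have : U \ A = U ∩ t ⁻¹' {0}ᶜ := by ext x; simp [hA]
    rw [this]
    exact ht.continuousOn.isOpen_inter_preimage hU isOpen_compl_singleton
  have hthin : ∀ a ∈ A ∩ U, ∃ (φ : E → ℂ) (W : Set E), IsOpen W ∧ a ∈ W ∧ W ⊆ U ∧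
      DifferentiableOn ℂ φ W ∧ (∀ x ∈ A ∩ W, φ x = 0) ∧ ¬ φ =ᶠ[𝓝 a] 0 := fun a ha ↦
    ⟨t, U, hU, ha.2, Subset.rfl, ht, fun x hx ↦ hx.1,
      not_eventuallyEq_zero_of_fderiv_ne_zero (hdt a ha.2 ha.1)⟩
  have hg₀ : DifferentiableOn ℂ (fun x ↦ (t x)⁻¹ • f x) (U \ A) := fun x hx ↦
    ((ht x hx.1).inv hx.2).smul (hf x hx.1) |>.mono sdiff_subset
  have hbdd : ∀ x ∈ A ∩ U, ∃ W ∈ 𝓝 x, ∃ C : ℝ, ∀ y ∈ W \ A, ‖(t y)⁻¹ • f y‖ ≤ C := fun a ha ↦ by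
    obtain ⟨W, hW, C, hC⟩ := exists_bound_smul_inv_near_zero hU ht hf ha.2 ha.1 (hdt a ha.2 ha.1) hft
    exact ⟨W, hW, C, fun y hy ↦ hC y hy.1 hy.2⟩
  obtain ⟨g, hg, hgf⟩ := exists_differentiableOn_eqOn_of_thin hUA hthin hg₀ hbdd
  refine ⟨g, hg, fun x hx ↦ ?_⟩
  have key : EqOn f (fun x ↦ t x • g x) U := by
    refine eqOn_of_eqOn_diff_of_thin hU hthin hf.continuousOn (ht.continuousOn.smul hg.continuousOn)
      fun y hy ↦ ?_
    rw [hgf hy, smul_smul, mul_inv_cancel₀ hy.2, one_smul]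
  exact key hx

omit [CompleteSpace F] in
/-- **Uniqueness of the quotient**: if `t • g₁ = t • g₂` on `U` with `t` a reduced equation as
above and `g₁, g₂` continuous on `U`, then `g₁ = g₂` on `U` (the complement of the thin set
`{t = 0}` is dense). [folklore] -/
theorem eqOn_of_smul_eq_smul {t : E → ℂ} {g₁ g₂ : E → F} {U : Set E} (hU : IsOpen U)
    (ht : DifferentiableOn ℂ t U) (hdt : ∀ x ∈ U, t x = 0 → fderiv ℂ t x ≠ 0)
    (hg₁ : ContinuousOn g₁ U) (hg₂ : ContinuousOn g₂ U) (h : ∀ x ∈ U, t x • g₁ x = t x • g₂ x) :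
    EqOn g₁ g₂ U := by
  set A : Set E := t ⁻¹' {0} with hA
  have hthin : ∀ a ∈ A ∩ U, ∃ (φ : E → ℂ) (W : Set E), IsOpen W ∧ a ∈ W ∧ W ⊆ U ∧
      DifferentiableOn ℂ φ W ∧ (∀ x ∈ A ∩ W, φ x = 0) ∧ ¬ φ =ᶠ[𝓝 a] 0 := fun a ha ↦
    ⟨t, U, hU, ha.2, Subset.rfl, ht, fun x hx ↦ hx.1,
      not_eventuallyEq_zero_of_fderiv_ne_zero (hdt a ha.2 ha.1)⟩
  refine eqOn_of_eqOn_diff_of_thin hU hthin hg₁ hg₂ fun y hy ↦ ?_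
  exact smul_right_injective F (show t y ≠ 0 from hy.2) (h y hy.1)

end Division


end SCV
end Literature.Analysis.Complex
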